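import Summits.QuantumFields.YangMills.Theorems.AllWindowsColdBoxBoxWindowHighSU2213LineDefs
import Summits.QuantumFields.YangMills.Theorems.AllWindowsColdBoxBoxHighLineKernelHodgeForm

/-!
# LINE-18 K1 from LINE-20 U1c: `LandauDipoleDecay → DirKernelDipoleDecay` (gauge change of the projection kernel)

The registered stub K1 `stub_kernelDipoleDecay : DirKernelDipoleDecay` of LINE-18 «BulkMidWindowSU2 birth v5» (crux
`AllWindowsColdBox.BulkMidWindowSU2`, ⟨stmt-QuantumFields-24006⟩) asks for the dipole–dipole law of the Dirichlet box projection kernel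
`boxDirProjKernel H p q`.  By the landed gauge change S2 `stub_kernelHodgeForm : DirProjKernelHodgeForm` (✓, file `…KernelHodgeForm`) this
kernel IS the Landau/Hodge dipole form `λ_p · hodgeQ⁻¹ λ_q`, so K1 is literally LINE-20's U1c `LandauDipoleDecay` (⟨stmt-QuantumFields-24336⟩,
file `…BoxWindowHighSU2213LineDefs`; the two distance weights are the same ℓ¹ corner distance).  This file copies the two LINE-18 definitions
VERBATIM from the registered skeleton v5 (`plaqDist`, `DirKernelDipoleDecay`, sha16 3c750a37…, namespace of the line's by-name files
`…AllWindowsColdBoxBulkMidLine`, precedent ✓p722834) and proves the bridge `dirKernelDipoleDecay_of_landauDipoleDecay`.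

HONEST LABEL: a conditional bridge; K1 is NOT proved here (it closes by name the moment U1c lands); no crux, rung or summit is proved; the
Yang–Mills mass gap is NOT proved by this file.
-/

set_option autoImplicit false

noncomputable section

open Literature.MathematicalPhysics.QuantumFieldTheory
open Summit.QuantumFields.YangMills.Theorems.WeakCouplingRates

namespace Summit.QuantumFields.YangMills.Theorems.AllWindowsColdBoxBulkMidLine

/-- ℓ¹ distance between the corners of two plaquette keys of `ℤ⁴` (cast to `ℝ`). (Verbatim from the LINE-18 skeleton v5.) -/
def plaqDist (p q : Plaq 4) : ℝ := ((∑ m : Fin 4, |p.1 m - q.1 m| : ℤ) : ℝ)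

/-- **Obligation K1** of LINE-18 (verbatim from the skeleton v5): the dipole–dipole law of the Dirichlet box projection kernel,
`|K_H(p,q)| ≤ c·(1 + log H)/(1 + dist(p,q))⁴` uniformly in the box including its walls. -/
def DirKernelDipoleDecay : Prop :=
  ∃ c : ℝ, 0 < c ∧ ∀ H : ℕ, 1 ≤ H → ∀ p q : Plaq 4,
    |boxDirProjKernel H p q| ≤ c * (1 + Real.log H) / (1 + plaqDist p q) ^ 4

/-- `plaqDist ≥ 0`. -/
theorem plaqDist_nonneg (p q : Plaq 4) : 0 ≤ plaqDist p q := by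
  unfold plaqDist
  exact_mod_cast Finset.sum_nonneg fun m _ => abs_nonneg (p.1 m - q.1 m)

/-- **K1 from U1c**: the Landau/Hodge dipole decay `LandauDipoleDecay` (LINE-20 U1c) implies `DirKernelDipoleDecay` (LINE-18 K1), by the
gauge change `stub_kernelHodgeForm`. -/
theorem dirKernelDipoleDecay_of_landauDipoleDecay (h : AllWindowsColdBoxBoxHighLine.LandauDipoleDecay) : DirKernelDipoleDecay := by
  obtain ⟨C, hC⟩ := h
  refine ⟨max C 1, lt_of_lt_of_le one_pos (le_max_right _ _), fun H hH p q => ?_⟩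
  rw [AllWindowsColdBoxBoxHighLine.stub_kernelHodgeForm H hH p q]
  have h1 := hC H hH p q
  have hlog : 0 ≤ 1 + Real.log H := by
    have := Real.log_nonneg (show (1 : ℝ) ≤ H by exact_mod_cast hH); linarith
  have hd : 0 < (1 + plaqDist p q) ^ 4 := by have := plaqDist_nonneg p q; positivity
  have hden : (1 + (((∑ m : Fin 4, |p.1 m - q.1 m|) : ℤ) : ℝ)) ^ 4 = (1 + plaqDist p q) ^ 4 := rfl
  rw [hden] at h1
  refine h1.trans ?_
  rw [div_le_div_iff_of_pos_right hd]
  exact mul_le_mul_of_nonneg_right (le_max_left _ _) hlog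

end Summit.QuantumFields.YangMills.Theorems.AllWindowsColdBoxBulkMidLine

end
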